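import Literature.AlgebraicGeometry.AbelianSchemes.AbelianSchemeQuotientPoincarePullback
import HarnessLib

/-!
# Slices of `𝒩₁ = (π × 1)^*𝒫` at sections of `Â` and their pull-back along `ψ` (HECKE-LINK H2, bookkeeping for (K4)/(K5))

Layer `Literature/AlgebraicGeometry/AbelianSchemes`, namespace `Literature.AlgebraicGeometry.AbelianSchemes.AbelianSchemeOver`.
Cell `hodgecm-mathlib`, HECKE-LINK line card v1.2, (K)-plan of record 21:39:01Z ((K4) character step, B-p06 (g9); (K5) counting,
B-p15 (g10)), over ★ (ii) part 1 `AbelianSchemeQuotientPoincarePullback` (p744103: `mulNDescProdSection c = (π × c)`, `dualKernelSet`,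
`poincarePullback = 𝒩₁`) and ★ D0 (p742656: `ψ ≫ π = [n]`).  [MumfordAV1970] §15 Thm. 1 (p. 143); §23.  THEOREMS ONLY:
* `quotientMk_comp_mulNDescProdSection : ψ ≫ (π × c) = ([n] × c)` — so the line bundle `L_c := (π × c)^*𝒫` on `B = A/K` pulls back
  along `ψ` to `([n] × c)^*𝒫` (`nonempty_pullback_quotientMk_sliceModule_iso`), the input shape of the character step (K4);
* `sectionSlice_comp_whiskerRight : (B × c) ≫ (π ▷ Â) = (π × c)` and `baseChangeHom_left_eq_whiskerRight_left :
  (π_{Â}).left = (π ▷ Â).left`, whence `L_c ≅ (B × c)^*𝒩₁` (`nonempty_sliceModule_iso_pullback_poincarePullback`) — the slice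
  of `𝒩₁` at the constant section `c`, as (K4) reads it.
No definition, no instance, no sorry.  HC_CM is proved only modulo the 7 printed citations until rung 0 closes; nothing here is
about HC.

## References
* [MumfordAV1970] D. Mumford, *Abelian Varieties* (1970), §15 Thm. 1 (p. 143), §23 (p. 231).
-/

noncomputable section

universe u

open CategoryTheory CategoryTheory.Limits AlgebraicGeometry MonoidalCategory CartesianMonoidalCategory
open scoped MonObj

namespace Literature.AlgebraicGeometry.AbelianSchemes

namespace AbelianSchemeOver

open Literature.AlgebraicGeometry.RelativeSpec

variable {S : Scheme.{u}} (A : AbelianSchemeOver S)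
  {Y : Scheme.{u}} (u : S ⟶ Y) (K : Subgroup A.Sections) [IsCommMonObj A.X] {n : ℕ}
  (hK : ∀ σ : K, (σ : A.Sections) ^ n = 1)
  [Finite K] [Y.IsSeparated] [IsSeparated (A.X.hom ≫ u)] [S.IsSeparated]
  (hcov : ∀ x : A.left, ∃ O : (A.translationActionOver u K).StableAffineOpens, x ∈ O.1)
  [LocallyOfFiniteType (A.X.hom ≫ u)] [IsLocallyNoetherian Y]
  (hG : ∃ _ : GrpObj (A.quotientOver u K), IsMonHom (A.quotientMk u K hcov))
  (hsm : Smooth (A.quotientOver u K).hom) (hgc : GeometricallyConnected (A.quotientOver u K).hom)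
  (D : A.DualPair)

/-! ## §1 `ψ ≫ (π × c) = ([n] × c)` -/

/-- **`ψ ≫ (π × c) = ([n] × c) : A → A ⊗ Â`** (★ `quotientMk_comp_mulNDesc`). [cite: MumfordAV1970, §15 Thm. 1 (p. 143)] -/
theorem quotientMk_comp_mulNDescProdSection (c : D.hat.Sections) :
    (A.quotientMk u K hcov : A.X ⟶ (A.quotientBy u K hcov hG hsm hgc).X) ≫
        A.mulNDescProdSection u K hK hcov hG hsm hgc D c =
      CartesianMonoidalCategory.lift (A.mulN n) (toUnit _ ≫ c) := by
  unfold mulNDescProdSection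
  erw [CartesianMonoidalCategory.comp_lift]
  congr 1
  · exact A.quotientMk_comp_mulNDesc u K hK hcov
  · exact (Category.assoc _ _ _).symm.trans
      (congrArg (fun t => t ≫ c) (toUnit_unique (A.quotientMk u K hcov ≫ toUnit ((A.quotientBy u K hcov hG hsm hgc).X)) (toUnit A.X)))

/-- **`ψ^* L_c ≅ ([n] × c)^*𝒫`** for the slice module `L_c := (π × c)^*𝒫` on `B = A/K` — the input shape of the character
step (K4): for `c ∈ Â[n](S)` the right-hand side is trivial by `[n]^*P_c ≅ P_{c^n}` and the unit normalisation.
[cite: MumfordAV1970, §15 Thm. 1 (p. 143)] [cite: MumfordAV1970, §23 (p. 231)] -/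
theorem nonempty_pullback_quotientMk_sliceModule_iso (c : D.hat.Sections) :
    Nonempty ((Scheme.Modules.pullback (A.quotientMk u K hcov).left).obj
        ((Scheme.Modules.pullback (A.mulNDescProdSection u K hK hcov hG hsm hgc D c).left).obj D.P) ≅
      (Scheme.Modules.pullback (CartesianMonoidalCategory.lift (A.mulN n) (toUnit _ ≫ c)).left).obj D.P) := by
  have h : ((A.quotientMk u K hcov : A.X ⟶ (A.quotientBy u K hcov hG hsm hgc).X) ≫
      A.mulNDescProdSection u K hK hcov hG hsm hgc D c).left =
      (CartesianMonoidalCategory.lift (A.mulN n) (toUnit _ ≫ c)).left :=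
    congrArg Over.Hom.left (A.quotientMk_comp_mulNDescProdSection u K hK hcov hG hsm hgc D c)
  exact ⟨(Scheme.Modules.pullbackComp _ _).app _ ≪≫ (Scheme.Modules.pullbackCongr h).app _⟩

/-! ## §2 `L_c` is the slice of `𝒩₁` at the constant section `c` -/

omit [Finite K] [Y.IsSeparated] [IsSeparated (A.X.hom ≫ u)] [S.IsSeparated] [LocallyOfFiniteType (A.X.hom ≫ u)]
  [IsLocallyNoetherian Y] [IsCommMonObj A.X] in
/-- **`(B × c) ≫ (π ▷ Â) = (π × c)`** in `Over S`. [cite: MumfordAV1970, §15 Thm. 1 (p. 143)] -/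
theorem sectionSlice_comp_whiskerRight {B : Over S} (p : B ⟶ A.X) (c : D.hat.Sections) :
    CartesianMonoidalCategory.lift (𝟙 B) (toUnit _ ≫ c) ≫ (p ▷ D.hat.X) =
      CartesianMonoidalCategory.lift p (toUnit _ ≫ c) := by
  rw [← tensorHom_id, CartesianMonoidalCategory.lift_map, Category.id_comp, Category.comp_id]

omit [Finite K] [Y.IsSeparated] [IsSeparated (A.X.hom ≫ u)] [S.IsSeparated] [LocallyOfFiniteType (A.X.hom ≫ u)]
  [IsLocallyNoetherian Y] [IsCommMonObj A.X] in
/-- `(p_{Â}).left = (p ▷ Â).left`: the base change of an `S`-morphism `p : B → A` to `Â` (★ `baseChangeHom`, an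
`Over.pullback` map) and the whiskering `p ▷ Â` have the same underlying scheme morphism `B ×_S Â → A ×_S Â`.
[cite: MumfordAV1970, §15 Thm. 1 (p. 143)] -/
theorem baseChangeHom_left_eq_whiskerRight_left (B : AbelianSchemeOver S) (p : B.X ⟶ A.X) :
    (baseChangeHom p D.hat.X.hom).left = (p ▷ D.hat.X).left := by
  apply pullback.hom_ext
  · erw [Over.whiskerRight_left_fst]
  · erw [Over.whiskerRight_left_snd]

variable [IsAffine Y]
  (hfree : ∀ (Ω : Type u) [Field Ω] [IsAlgClosed Ω] (x : Spec (.of Ω) ⟶ A.left) (σ : K), σ ≠ 1 →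
    x ≫ (A.translation (σ : A.Sections)).left ≠ x)

/-- **`L_c ≅ (B × c)^*𝒩₁`**: the slice module `(π × c)^*𝒫` is the restriction of `𝒩₁ = (π × 1)^*𝒫` to the constant section
`c` of `Â`. [cite: MumfordAV1970, §15 Thm. 1 (p. 143)] -/
theorem nonempty_sliceModule_iso_pullback_poincarePullback (c : D.hat.Sections) :
    Nonempty ((Scheme.Modules.pullback (A.mulNDescProdSection u K hK hcov hG hsm hgc D c).left).obj D.P ≅
      (Scheme.Modules.pullback
          (CartesianMonoidalCategory.lift (𝟙 (A.quotientBy u K hcov hG hsm hgc).X) (toUnit _ ≫ c)).left).obj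
        (A.poincarePullback u K hK hcov hG hsm hgc D hfree)) := by
  -- `(π × c) = (B × c) ≫ (π ▷ Â)` in `Over S`, on underlying maps (`Over.comp_left` is `rfl`)
  have e₀ := congrArg Over.Hom.left
    (A.sectionSlice_comp_whiskerRight D (B := (A.quotientBy u K hcov hG hsm hgc).X) (A.mulNDesc u K hK hcov) c)
  -- `(π_{Â}).left = (π ▷ Â).left`, the map along which `𝒩₁` is defined
  have e₁ := A.baseChangeHom_left_eq_whiskerRight_left D (A.quotientBy u K hcov hG hsm hgc) (A.mulNDesc u K hK hcov)
  rw [poincarePullback_eq]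
  exact ⟨(Scheme.Modules.pullbackCongr e₀.symm).app _ ≪≫ ((Scheme.Modules.pullbackComp _ _).app _).symm ≪≫
    (Scheme.Modules.pullback _).mapIso ((Scheme.Modules.pullbackCongr e₁.symm).app _)⟩

end AbelianSchemeOver

end Literature.AlgebraicGeometry.AbelianSchemes

end
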